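import Summits.AtomisticToContinuum.HydrodynamicLimit.Theorems.MourreKoopmanChargesLinearToEntropyInBandBallContentDefs
import Summits.AtomisticToContinuum.HydrodynamicLimit.Theorems.MourreKoopmanChargesLinearToEntropyInBandSpliceCore
import Literature.Analysis.FunctionSpaces.PoissonTwoColourSeries
import HarnessLib

/-!
# Route `MourreKoopmanCharges`, crux `LinearToEntropyInBand` (stmt-AtomisticToContinuum-17740), skeleton v8,
# stub 4a-i `stub_visibleOneBlockEstimateInBand`: ball contents are measurable; the splice law has the prescribed
# ball marginal and relative entropy (AUDIT-4a § 3 items 0–1 in situ)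

Support file (`--supports stmt-AtomisticToContinuum-17740`; registered toolkit stub `stub_ballContentSplice`) of the
line `registered` (`Cruxes/LinearToEntropyInBand/Lines/birth.lean`), serving stub 4a-i (THE ball-wise localisation,
promoted to an item in wave 4).  The objects are those of part D of the objects module
(`…LinearToEntropyInBandBallContentDefs`, p169961): `ballContent B z` (the unlabelled phase-space content of the
labelled configuration `z` over `B ⊆ 𝕋³`, a `PointConfig (T3 × V3)`), `ballMarginal B μ = μ ∘ (ballContent B)⁻¹`,
the graph law `ballJoint B G` and the splice `spliceLaw B f G = (ballJoint B G).condKernel ∘ₘ ballMarginal B f`.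
Proved here:

* § 1 `measurable_ballContent` (item 0a): for measurable `B` the ball-content map is measurable for the count
  σ-algebra — it is the tree's measurable tuple-to-configuration map `PointConfig.ofFn`
  (`PointConfig.measurable_ofFn_fintype`, Last–Penrose (4.11) at `c = ∅`) followed by the measurable restriction to
  the window `B ×ˢ univ` (`PointConfig.measurable_restrict`); `measurableSet_graph_ballContent` (item 0b): its graph
  is measurable, by the measurable diagonal of `PointConfig (T3 × V3)` (`instMeasurableEqPointConfig` of part D);
  `isProbabilityMeasure_ballMarginal`, and the unfolding lemmas `mem_ballContent`, `count_ballContent`, `spliceLaw_eq`.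
* § 2 `ballMarginal_spliceLaw` (item 1a): `(spliceLaw B f G)|_B = f|_B` for a probability reference `G` and any law
  `f` with `f|_B ≪ G|_B`; `klDiv_spliceLaw` (item 1b, `ballSplice_klDiv_eq`): `KL(spliceLaw B f G ‖ G) =
  KL(f|_B ‖ G|_B)` for probabilities `f`, `G` with `f|_B ≪ G|_B` — the specialisations `T := ballContent B`,
  `Q := G`, `α := f|_B` of the landed abstract splice core (`map_condKernel_comp_eq`, `klDiv_condKernel_comp_eq'` of
  `…LinearToEntropyInBandSpliceCore`, p169208); and the bookkeeping the transfers of item 4 use: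
  `isProbabilityMeasure_spliceLaw`, `spliceLaw_self` (`spliceLaw B G G = G`, non-vacuity) and
  `spliceLaw_absolutelyContinuous` (`spliceLaw B f G ≪ G` under `f|_B ≪ G|_B`).
* § 3 the registered stub `stub_ballContentSplice` (conjunction of the four).

The absolute-continuity hypothesis is necessary (off the support of `G|_B` the conditional kernel is arbitrary) and
is NOT hidden: for the profile reference `ψ` of the line against the frozen homogeneous law `G_{M_B}` it holds only
after truncation of the ball counts (sizing memo `VOBE-DECOMPOSITION` § 1).  Nothing here restates the crux, a stub
of a neighbour or the Statement; no definition is introduced.  References (folklore): Kingman, *Poisson Processes*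
(1993) § 2.1; Last–Penrose, *Lectures on the Poisson Process* (2017) § 2.1, (4.11); Kallenberg, *Foundations of
Modern Probability* (2002) Thm 6.3–6.4; Yau, Lett. Math. Phys. 22 (1991) § 2.
-/

noncomputable section

open MeasureTheory Filter Set ProbabilityTheory InformationTheory
open scoped ENNReal Topology

namespace Summit.AtomisticToContinuum.HydrodynamicLimit.Theorems.LTEInBand

open Literature.MathematicalPhysics.KineticTheory Literature.Analysis.FluidPDE Literature.Analysis.FunctionSpaces

variable {B : Set T3}

/-! ### § 1 Unfolding lemmas and measurability of the ball content -/

/-- Unfolding: the ball content is the set of values of the tuple restricted to the window `B ×ˢ univ`. -/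
theorem ballContent_eq_restrict_ofFn (B : Set T3) {n : ℕ} (z : Config n (Fin 3) T3) :
    ballContent B z = (PointConfig.ofFn z).restrict (B ×ˢ Set.univ) := rfl

/-- The points of the ball content of `z` are the phase points `z i` whose position lies in `B`. -/
theorem mem_ballContent {B : Set T3} {n : ℕ} {z : Config n (Fin 3) T3} {p : T3 × V3} :
    p ∈ ballContent B z ↔ (∃ i, z i = p) ∧ p.1 ∈ B := by
  change p ∈ Set.range z ∩ B ×ˢ Set.univ ↔ _
  simp

/-- Counting: `N_{ballContent B z}(s) = N_{ofFn z}((B ×ˢ univ) ∩ s)`. -/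
theorem count_ballContent (B : Set T3) {n : ℕ} (z : Config n (Fin 3) T3) (s : Set (T3 × V3)) :
    (ballContent B z).count s = (PointConfig.ofFn z).count (B ×ˢ Set.univ ∩ s) :=
  PointConfig.count_restrict _ _ _

/-- **Item 0a: the ball-content map is measurable** for the count σ-algebra (measurable `B`): it is the
composition of the measurable tuple-to-configuration map `PointConfig.ofFn` (`measurable_ofFn_fintype`) with the
measurable restriction to the window `B ×ˢ univ` (`PointConfig.measurable_restrict`). [folklore] -/
theorem measurable_ballContent (hB : MeasurableSet B) (n : ℕ) :
    Measurable (ballContent B : Config n (Fin 3) T3 → PointConfig (T3 × V3)) :=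
  (PointConfig.measurable_restrict (hB.prod MeasurableSet.univ)).comp
    (PointConfig.measurable_ofFn_fintype (E := T3 × V3) (Fin n))

/-- The graph `{(ξ, z) | ξ = ballContent B z}` is measurable (measurable diagonal of `PointConfig`). -/
theorem measurableSet_graph_ballContent (hB : MeasurableSet B) (m : ℕ) :
    MeasurableSet {p : PointConfig (T3 × V3) × Config m (Fin 3) T3 | p.1 = ballContent B p.2} :=
  measurableSet_graph_of_measurableEq (measurable_ballContent hB m)

/-- The ball marginal of a probability measure is a probability measure. -/
theorem isProbabilityMeasure_ballMarginal (hB : MeasurableSet B) {n : ℕ} (μ : Measure (Config n (Fin 3) T3))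
    [IsProbabilityMeasure μ] : IsProbabilityMeasure (ballMarginal B μ) :=
  Measure.isProbabilityMeasure_map (measurable_ballContent hB n).aemeasurable

/-- Unfolding of the splice law for a finite reference `G`. -/
theorem spliceLaw_eq {n m : ℕ} (f : Measure (Config n (Fin 3) T3)) (G : Measure (Config m (Fin 3) T3))
    [hG : IsFiniteMeasure G] :
    spliceLaw B f G = (ballJoint B G).condKernel ∘ₘ ballMarginal B f := by
  rw [spliceLaw, dif_pos hG]

/-! ### § 2 The two identities of the splice law -/

/-- **Item 1a: the splice has the prescribed ball marginal**: for a probability reference `G` on the `m`-system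
and ANY law `f` on the `n`-system with `f|_B ≪ G|_B`, `(spliceLaw B f G)|_B = f|_B`
(`map_condKernel_comp_eq` with `T = ballContent B`, `Q = G`, `α = f|_B`).  The a.c. hypothesis is necessary and,
for the profile reference of the line against the frozen homogeneous law, holds only after truncation of the ball
counts. [folklore] -/
theorem ballMarginal_spliceLaw (hB : MeasurableSet B) {n m : ℕ} (f : Measure (Config n (Fin 3) T3))
    (G : Measure (Config m (Fin 3) T3)) [IsProbabilityMeasure G]
    (hac : ballMarginal B f ≪ ballMarginal B G) :
    ballMarginal B (spliceLaw B f G) = ballMarginal B f := by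
  rw [spliceLaw_eq]
  exact map_condKernel_comp_eq G (measurable_ballContent hB m) (ballMarginal B f) hac

/-- **Item 1b (`ballSplice_klDiv_eq`): relative entropy of the splice** w.r.t. the reference is that of the ball
marginals: `KL(spliceLaw B f G ‖ G) = KL(f|_B ‖ G|_B)` for probability measures `f`, `G` with `f|_B ≪ G|_B`
(`klDiv_condKernel_comp_eq'`, the graph being measurable by `MeasurableEq (PointConfig (T3 × V3))`). [folklore] -/
theorem klDiv_spliceLaw (hB : MeasurableSet B) {n m : ℕ} (f : Measure (Config n (Fin 3) T3))
    [IsProbabilityMeasure f] (G : Measure (Config m (Fin 3) T3)) [IsProbabilityMeasure G]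
    (hac : ballMarginal B f ≪ ballMarginal B G) :
    klDiv (spliceLaw B f G) G = klDiv (ballMarginal B f) (ballMarginal B G) := by
  haveI := isProbabilityMeasure_ballMarginal hB f
  rw [spliceLaw_eq]
  exact klDiv_condKernel_comp_eq' G (measurable_ballContent hB m) (ballMarginal B f) hac


/-- The splice of probability laws is a probability law (Markov conditional kernel). -/
theorem isProbabilityMeasure_spliceLaw (hB : MeasurableSet B) {n m : ℕ} (f : Measure (Config n (Fin 3) T3))
    [IsProbabilityMeasure f] (G : Measure (Config m (Fin 3) T3)) [IsProbabilityMeasure G] :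
    IsProbabilityMeasure (spliceLaw B f G) := by
  haveI := isProbabilityMeasure_ballMarginal hB f
  rw [spliceLaw_eq]
  infer_instance

/-- **Sanity (non-vacuity): splicing the reference's own ball marginal returns the reference**,
`spliceLaw B G G = G` (disintegration `ρ.fst ⊗ₘ ρ.condKernel = ρ` of the graph law, whose marginals are `G|_B`
and `G`). [folklore] -/
theorem spliceLaw_self (hB : MeasurableSet B) {m : ℕ} (G : Measure (Config m (Fin 3) T3)) [IsProbabilityMeasure G] :
    spliceLaw B G G = G := by
  rw [spliceLaw_eq]
  have hfst : (ballJoint B G).fst = ballMarginal B G := fst_map_graph G (ballContent B)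
  have hsnd : (ballJoint B G).snd = G := snd_map_graph G (measurable_ballContent hB m)
  calc (ballJoint B G).condKernel ∘ₘ ballMarginal B G
        = ((ballJoint B G).fst ⊗ₘ (ballJoint B G).condKernel).snd := by rw [Measure.snd_compProd, hfst]
    _ = G := by rw [(ballJoint B G).disintegrate (ballJoint B G).condKernel, hsnd]

/-- **The splice is absolutely continuous w.r.t. the reference** when `f|_B ≪ G|_B` (composition with a kernel
preserves `≪`, and `spliceLaw B G G = G`) — the form in which the entropy inequality against the invariant `G`
is applied to the splice downstream (item 4 of the memo). [folklore] -/
theorem spliceLaw_absolutelyContinuous (hB : MeasurableSet B) {n m : ℕ} (f : Measure (Config n (Fin 3) T3))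
    (G : Measure (Config m (Fin 3) T3)) [IsProbabilityMeasure G] (hac : ballMarginal B f ≪ ballMarginal B G) :
    spliceLaw B f G ≪ G := by
  have h := hac.comp_right (ballJoint B G).condKernel
  rw [← spliceLaw_eq f G, ← spliceLaw_eq G G, spliceLaw_self hB G] at h
  exact h

/-! ### § 3 The registered toolkit stub -/

/-- **Registered toolkit stub `stub_ballContentSplice` of crux stmt-AtomisticToContinuum-17740** (serving stub 4a-i
`stub_visibleOneBlockEstimateInBand`; AUDIT-4a § 3 items 0–1 in situ): the conjunction of `measurable_ballContent`,
`measurableSet_graph_ballContent`, `ballMarginal_spliceLaw` (the splice has the prescribed ball marginal) and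
`klDiv_spliceLaw` (`KL(splice ‖ G) = KL(f|_B ‖ G|_B)`), both identities under the necessary hypothesis
`f|_B ≪ G|_B`. [folklore] -/
theorem stub_ballContentSplice : (∀ {B : Set Literature.MathematicalPhysics.KineticTheory.T3}, MeasurableSet B → ∀ n : ℕ, Measurable (Summit.AtomisticToContinuum.HydrodynamicLimit.Theorems.LTEInBand.ballContent B : Literature.Analysis.FluidPDE.Config n (Fin 3) Literature.MathematicalPhysics.KineticTheory.T3 → Literature.Analysis.FunctionSpaces.PointConfig (Literature.MathematicalPhysics.KineticTheory.T3 × Literature.MathematicalPhysics.KineticTheory.V3))) ∧ (∀ {B : Set Literature.MathematicalPhysics.KineticTheory.T3}, MeasurableSet B → ∀ m : ℕ, MeasurableSet {p : Literature.Analysis.FunctionSpaces.PointConfig (Literature.MathematicalPhysics.KineticTheory.T3 × Literature.MathematicalPhysics.KineticTheory.V3) × Literature.Analysis.FluidPDE.Config m (Fin 3) Literature.MathematicalPhysics.KineticTheory.T3 | p.1 = Summit.AtomisticToContinuum.HydrodynamicLimit.Theorems.LTEInBand.ballContent B p.2}) ∧ (∀ {B : Set Literature.MathematicalPhysics.KineticTheory.T3},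 MeasurableSet B → ∀ {n m : ℕ} (f : MeasureTheory.Measure (Literature.Analysis.FluidPDE.Config n (Fin 3) Literature.MathematicalPhysics.KineticTheory.T3)) (G : MeasureTheory.Measure (Literature.Analysis.FluidPDE.Config m (Fin 3) Literature.MathematicalPhysics.KineticTheory.T3)) [MeasureTheory.IsProbabilityMeasure G], (Summit.AtomisticToContinuum.HydrodynamicLimit.Theorems.LTEInBand.ballMarginal B f).AbsolutelyContinuous (Summit.AtomisticToContinuum.HydrodynamicLimit.Theorems.LTEInBand.ballMarginal B G) → Summit.AtomisticToContinuum.HydrodynamicLimit.Theorems.LTEInBand.ballMarginal B (Summit.AtomisticToContinuum.HydrodynamicLimit.Theorems.LTEInBand.spliceLaw B f G) = Summit.AtomisticToContinuum.HydrodynamicLimit.Theorems.LTEInBand.ballMarginal B f) ∧ (∀ {B : Set Literature.MathematicalPhysics.KineticTheory.T3}, MeasurableSet B → ∀ {n m : ℕ} (f : MeasureTheory.Measure (Literature.Analysis.FluidPDE.Config n (Fin 3) Literature.MathematicalPhysics.KineticTheory.T3)) [MeasureTheory.IsProbabilityMeasure f] (G : MeasureTheory.Measure (Literature.Analysis.FluidPDE.Config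 m (Fin 3) Literature.MathematicalPhysics.KineticTheory.T3)) [MeasureTheory.IsProbabilityMeasure G], (Summit.AtomisticToContinuum.HydrodynamicLimit.Theorems.LTEInBand.ballMarginal B f).AbsolutelyContinuous (Summit.AtomisticToContinuum.HydrodynamicLimit.Theorems.LTEInBand.ballMarginal B G) → InformationTheory.klDiv (Summit.AtomisticToContinuum.HydrodynamicLimit.Theorems.LTEInBand.spliceLaw B f G) G = InformationTheory.klDiv (Summit.AtomisticToContinuum.HydrodynamicLimit.Theorems.LTEInBand.ballMarginal B f) (Summit.AtomisticToContinuum.HydrodynamicLimit.Theorems.LTEInBand.ballMarginal B G)) :=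
  ⟨fun hB n => measurable_ballContent hB n, fun hB m => measurableSet_graph_ballContent hB m,
    fun hB _ _ f G _ hac => ballMarginal_spliceLaw hB f G hac, fun hB _ _ f _ G _ hac => klDiv_spliceLaw hB f G hac⟩

end Summit.AtomisticToContinuum.HydrodynamicLimit.Theorems.LTEInBand

end
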